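import Summits.HodgeConjecture.HodgeConjecture.Theorems.HLiu418DoubledWeilMirrorPrep
import HarnessLib

/-!
# The SCALAR-CONJUGATE (mirror) of the `χ`-normalised doubled Weil representation is the `χ⁻¹`-normalised one at the
# negated line: `IsDoubledWeilRep χ sD → IsDoubledWeilRep χ⁻¹ (mpCongr ∘ (·)ᶜ ∘ sD ∘ (H_{dW′} = H_{dW}))`, `dW′ = −dW`

Cell `hodgecm-mathlib`, floor 0, programme P5 (`Cruxes/HLiu418/Lines/F0_AlbCm.lean`), crux item `stmt-HodgeConjecture-24832`; K-E3 lane, ROAD U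
step (U1), part 2 of 2 (preparations: ★ `HLiu418DoubledWeilMirrorPrep.lean`).  THEOREMS ONLY (no definition, no named fact, no instance, no `sorry`); rank-GENERIC (`N`, `M` arbitrary).

The complex-conjugate twin of ★ `isDoubledWeilRep_relabel_comp_conj` (`DoubledWeilRepresentationRelabel`, Galois conjugation `h ↦ h̄` +
the relabelling `Λ`).  Here the group element does NOT move (`H_{dW′}(𝔸) = H_{dW}(𝔸)` for `realDiagonal dW′ = −realDiagonal dW`, ★ `HA_eq`), the
operator is conjugated by `C : Φ ↦ Φ̄` (★ `adelicMpContConj`: `(g, M) ↦ (g, C M C)`, `Mp_ψ(𝕎_T)ᶜᵒⁿᵗ ≃* Mp_ψ(𝕎_{−T})ᶜᵒⁿᵗ`, [Li1992, p. 181] «`ω*` is `ω_{ψ̄}`»)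
and re-typed along `−T^𝔻(dW) = T^𝔻(dW′)` (★ `mpCongr`, ★ `gramDA_eq_neg`).  The one new point w.r.t. the relabelling route is Weil's rational
element `δ` of the parabolic normalisation: `C` fixes symplectic components, so `(r_T(δ))ᶜ = r_{−T}(Λ δ Λ)` (★ `adelicMpContConj_ratThetaLiftCont`),
and `Λ δ Λ ≠ δ`; but **`Λ δ Λ = m(ρ) · δ`** for the RATIONAL LEVI element `m(ρ)`, `ρ = 1_𝕎 ⊕ (−1_{𝕎⁻})` (§1, a block-matrix identity), whose
Θ-rigid lift `r(m(ρ)) = (m(ρ), Φ ↦ Φ(· ρ))` (★ `coe_ratThetaLiftCont_levi`) preserves values at the origin (§2); so the value-at-the-origin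
scalar of `r′(δ) sD′(p) r′(δ)⁻¹ = r′(m ρ)⁻¹ (r(δ) sD(p) r(δ)⁻¹)ᶜ r′(m ρ)` is the COMPLEX CONJUGATE of that of `r(δ) sD(p) r(δ)⁻¹`, i.e.
`conj (χ(det_Δ p)) |det_Δ p|^{1/2} = χ⁻¹(det_Δ p) |det_Δ p|^{1/2}` for unitary `χ` (§4–§5).

* §5 `opD_mirror_parabolic` — the value-at-the-origin scalar of `r′(δ) sD′(p) r′(δ)⁻¹` is `conj χ(det_Δ p) · |det_Δ p|^{1/2}`;
  **`isDoubledWeilRep_mirror`** (any continuous matrix-preserving `θ : H_{dW′}(𝔸) →* H_{dW}(𝔸)`) and **`isDoubledWeilRep_mirror_subgroupCongr`**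
  (`θ :=` the identity of matrices, ★ `HA_eq`).  (§1–§4: the preparation file.)

HC_CM is proved only modulo the 7 printed citations (+ declared floor-0 debt) until rung 0 closes; this file proves nothing about them.

## References
* [GelbartRogawski1991] S. Gelbart, J. Rogawski, Invent. Math. 105 (1991), §3.1 Prop. 3.1.1 p. 455 L1–2, Remark p. 457 L4–13.
* [Kudla1994] S. Kudla, Israel J. Math. 87 (1994), §2 (doubled space, Siegel parabolic), §3 Thm. 3.1.
* [HarrisKudlaSweet1996] M. Harris, S. Kudla, W. J. Sweet, J. AMS 9 (1996), §1 (1.14)–(1.15).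
* [Li1992] J.-S. Li, J. reine angew. Math. 428 (1992), p. 181.  [MoeglinVignerasWaldspurger1987] LNM 1291, Chap. 2 II.1.
* [Weil1964] A. Weil, Acta Math. 111 (1964), Chap. I n° 13 p. 160, Chap. III n° 40–41.
-/

set_option autoImplicit false
set_option linter.dupNamespace false

noncomputable section

open scoped Classical
open scoped Matrix ComplexConjugate
open NumberField IsDedekindDomain
open Literature.RepresentationTheory.HeisenbergGroup Literature.RepresentationTheory.HeisenbergGroup.SymplecticMatrix
open Literature.NumberTheory.Automorphic
open Literature.NumberTheory.Weil1964
open Literature.NumberTheory.GaloisRepresentations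
open Literature.NumberTheory.GelbartRogawski1991 Literature.NumberTheory.GelbartRogawski1991.UnitaryDualPair
open Literature.NumberTheory.GelbartRogawski1991.GRConstruction
open Literature.NumberTheory.Automorphic.UnitaryGroup

namespace Summit.HodgeConjecture.HodgeConjecture.Cruxes.HLiu418.DoubledWeilMirror

variable (L : Type) [Field L] [NumberField L] [IsCMField L]
variable {N M n : ℕ} (e : Fin N × Fin M ≃ Fin n)
  (dV : Fin N → L) (hdV : ∀ i, IsCMField.complexConj L (dV i) = dV i) (hdV0 : ∀ i, dV i ≠ 0)
  (dW : Fin M → L) (hdW : ∀ i, IsCMField.complexConj L (dW i) = dW i) (hdW0 : ∀ i, dW i ≠ 0)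
  (dW' : Fin M → L) (hdW' : ∀ i, IsCMField.complexConj L (dW' i) = dW' i) (hdW0' : ∀ i, dW' i ≠ 0)

/-! ## §5 The parabolic normalisation of the mirror and the transport theorem -/

section Mirror

variable {L e dV hdV dW hdW dW' hdW'}
variable {θ : HA L e dV hdV dW' hdW' →* HA L e dV hdV dW hdW}

/-- group bookkeeping: `r′ · A(B s) · r′⁻¹ = m⁻¹ · A(B(r s r⁻¹)) · m` when `A(B r) = m r′`, for multiplicative equivalences `A`, `B` (stated abstractly so
that no large type is unfolded). [folklore] -/
private theorem conj_eq_of_map_map {G H K : Type*} [Group G] [Group H] [Group K] (A : H ≃* K) (B : G ≃* H) {m r' : K} {r : G}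
    (hx : A (B r) = m * r') (s : G) : r' * A (B s) * r'⁻¹ = m⁻¹ * A (B (r * s * r⁻¹)) * m := by
  rw [map_mul, map_mul, map_inv, map_mul, map_mul, map_inv, hx]
  group

/-- `ω(a · b · c) Φ = ω(a) (ω(b) (ω(c) Φ))` on the group of record (term form; no `rw` through the operators). [folklore] -/
private theorem omega_mul_mul_apply {F : Type} [Field F] [NumberField F] {k : ℕ} {T : Matrix (Fin k) (Fin k) (AdeleRing (𝓞 F) F)}
    (a b c : adelicMpCont F (Fin k) T) (Φ : piSchwartzBruhat F (Fin k)) :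
    adelicMpCont.omega F (Fin k) T (a * b * c) Φ =
      adelicMpCont.omega F (Fin k) T a (adelicMpCont.omega F (Fin k) T b (adelicMpCont.omega F (Fin k) T c Φ)) :=
  (congrArg (fun S : Module.End ℂ (piSchwartzBruhat F (Fin k)) => S Φ)
    ((map_mul (adelicMpCont.omega F (Fin k) T) (a * b) c).trans
      (congrArg (· * adelicMpCont.omega F (Fin k) T c) (map_mul (adelicMpCont.omega F (Fin k) T) a b)))).trans
    ((Module.End.mul_apply _ _ Φ).trans (Module.End.mul_apply _ _ _))

/-- unfolding the mirror at a point: `((mpCongr ∘ (·)ᶜ ∘ sD) ∘ θ) h′ = mpCongr ((sD (θ h′))ᶜ)`. [cite: MoeglinVignerasWaldspurger1987, Chap. 2 II.1] -/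
theorem mirror_apply (hneg : realDiagonal L dW' hdW' = -realDiagonal L dW hdW) (sD : HA L e dV hdV dW hdW →* MpD L e dV hdV dW hdW)
    (h' : HA L e dV hdV dW' hdW') :
    (((mpCongr (gramDA_eq_neg (e := e) (dV := dV) (hdV := hdV) hneg).symm).toMonoidHom.comp
        ((adelicMpContConj (Fp L) (Fin (n + n)) (gramDA L e dV hdV dW hdW)).toMonoidHom.comp sD)).comp θ) h' =
      mpCongr (gramDA_eq_neg (e := e) (dV := dV) (hdV := hdV) hneg).symm
        (adelicMpContConj (Fp L) (Fin (n + n)) (gramDA L e dV hdV dW hdW) (sD (θ h'))) := rfl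

set_option maxHeartbeats 4000000 in
-- (the `IsDoubledWeilRep` telescopes of BOTH data and the conjugate-model casts are compared in `isDefEq`; every step is a term, no `rw`
-- through the Weil operators — the `T`/`−T` instances make `kabstract`/`rfl` time out)
/-- **THE VALUE-AT-THE-ORIGIN SCALAR OF THE MIRROR ON `P_Δ(𝔸)`.**  For `sD` `χ`-normalised at `dW`, a matrix-preserving `θ : H_{dW′}(𝔸) →* H_{dW}(𝔸)`
(`dW′ = −dW`) and `p ∈ P_Δ′(𝔸)` with `det_Δ p` a unit: the implementer `r′(δ) sD′(p) r′(δ)⁻¹` of the mirror `sD′ = mpCongr ∘ (·)ᶜ ∘ sD ∘ θ` has value-at-the-origin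
scalar `conj (χ(det_Δ p)) · |det_Δ p|^{1/2}` — because `(r(δ))ᶜ = r′(Λ δ Λ) = r′(m ρ) r′(δ)` (★ `adelicMpContConj_ratThetaLiftCont`, §1), so that
`r′(δ) sD′(p) r′(δ)⁻¹ = r′(m ρ)⁻¹ · (r(δ) sD(θ p) r(δ)⁻¹)ᶜ · r′(m ρ)`, the outer factors fix `Φ(0)` (§2) and `(Mᶜ Φ)(0) = conj ((M Φ̄)(0))`.
[cite: GelbartRogawski1991, §3.1 Prop. 3.1.1 p. 455 L1–2] [cite: HarrisKudlaSweet1996, §1 (1.14)–(1.15)] [cite: Li1992, p. 181] [cite: Weil1964, Chap. I n° 13 p. 160] -/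
theorem opD_mirror_parabolic (hdV0 : ∀ i, dV i ≠ 0) (hdW0 : ∀ i, dW i ≠ 0) (hdW0' : ∀ i, dW' i ≠ 0)
    (hneg : realDiagonal L dW' hdW' = -realDiagonal L dW hdW)
    (hθ : ∀ h : HA L e dV hdV dW' hdW',
      (((θ h : HA L e dV hdV dW hdW) : GL (Fin (n + n)) (AdeleRing (𝓞 L) L)) : Matrix (Fin (n + n)) (Fin (n + n)) (AdeleRing (𝓞 L) L)) =
        (((h : HA L e dV hdV dW' hdW') : GL (Fin (n + n)) (AdeleRing (𝓞 L) L)) : Matrix (Fin (n + n)) (Fin (n + n)) (AdeleRing (𝓞 L) L)))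
    (χ : HeckeCharacter L) {sD : HA L e dV hdV dW hdW →* MpD L e dV hdV dW hdW} (hsD : IsDoubledWeilRep L e dV hdV hdV0 dW hdW hdW0 χ sD)
    (ρ : GL (Fin (n + n)) (Fp L))
    (hρ : (ρ : Matrix (Fin (n + n)) (Fin (n + n)) (Fp L)) =
      Matrix.reindex (e₂ (n := n)) (e₂ (n := n)) (Matrix.fromBlocks (1 : Matrix (Fin n) (Fin n) (Fp L)) 0 0 (-1)))
    (p' : HA L e dV hdV dW' hdW') (hp' : IsSiegelDelta L e dV hdV dW' hdW' p') (hu' : IsUnit (detDelta L e dV hdV dW' hdW' p'))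
    (Φ : piSchwartzBruhat (Fp L) (Fin (n + n))) :
    opD L e dV hdV dW' hdW'
        (rDelta L e dV hdV hdV0 dW' hdW' hdW0' *
          (((mpCongr (gramDA_eq_neg (e := e) (dV := dV) (hdV := hdV) hneg).symm).toMonoidHom.comp
              ((adelicMpContConj (Fp L) (Fin (n + n)) (gramDA L e dV hdV dW hdW)).toMonoidHom.comp sD)).comp θ) p' *
          (rDelta L e dV hdV hdV0 dW' hdW' hdW0')⁻¹) Φ 0 =
      conj ((chiDet L e dV hdV dW' hdW' χ p' : ℂˣ) : ℂ) * (modDelta L e dV hdV dW' hdW' p' : ℂ) *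
        (Φ : (Fin (n + n) → AdeleRing (𝓞 (Fp L)) (Fp L)) → ℂ) 0 := by
  -- (F1) `mpCongr ((r(γ))ᶜ) = r′(Λ γ Λ)`
  have hΞr : ∀ γ : Matrix.symplecticGroup (Fin (n + n)) (Fp L),
      mpCongr (gramDA_eq_neg (e := e) (dV := dV) (hdV := hdV) hneg).symm
          (adelicMpContConj (Fp L) (Fin (n + n)) (gramDA L e dV hdV dW hdW) (rFD L e dV hdV hdV0 dW hdW hdW0 γ)) =
        rFD L e dV hdV hdV0 dW' hdW' hdW0' (negOffDiag γ) := fun γ =>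
    (congrArg (mpCongr (gramDA_eq_neg (e := e) (dV := dV) (hdV := hdV) hneg).symm)
      (adelicMpContConj_ratThetaLiftCont (Fp L) (gramDA L e dV hdV dW hdW) (isUnit_det_gramDA L e dV hdV hdV0 dW hdW hdW0) γ)).trans
        (mpCongr_ratThetaLiftCont (gramDA_eq_neg (e := e) (dV := dV) (hdV := hdV) hneg).symm _
          (isUnit_det_gramDA L e dV hdV hdV0 dW' hdW' hdW0') (negOffDiag γ))
  -- (F2) `mpCongr ((r(δ))ᶜ) = r′(m ρ) · r′(δ)`
  have hΞδ : mpCongr (gramDA_eq_neg (e := e) (dV := dV) (hdV := hdV) hneg).symm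
        (adelicMpContConj (Fp L) (Fin (n + n)) (gramDA L e dV hdV dW hdW) (rDelta L e dV hdV hdV0 dW hdW hdW0)) =
      rFD L e dV hdV hdV0 dW' hdW' hdW0' (levi ρ) * rDelta L e dV hdV hdV0 dW' hdW' hdW0' :=
    (hΞr (deltaD L)).trans ((congrArg (rFD L e dV hdV hdV0 dW' hdW' hdW0') (negOffDiag_deltaD n L ρ hρ)).trans
      (map_mul (rFD L e dV hdV hdV0 dW' hdW' hdW0') (levi ρ) (deltaD L)))
  -- (F3) `r′(δ) sD′(p) r′(δ)⁻¹ = r′(m ρ)⁻¹ · mpCongr ((r(δ) sD(θ p) r(δ)⁻¹)ᶜ) · r′(m ρ)`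
  have e3 := conj_eq_of_map_map (mpCongr (gramDA_eq_neg (e := e) (dV := dV) (hdV := hdV) hneg).symm)
    (adelicMpContConj (Fp L) (Fin (n + n)) (gramDA L e dV hdV dW hdW)) hΞδ (sD (θ p'))
  rw [mirror_apply hneg sD p', e3]
  -- (F4) the value at the origin
  have hpθ : IsSiegelDelta L e dV hdV dW hdW (θ p') := (isSiegelDelta_iff_of_coe_eq hθ p').2 hp'
  have huθ : IsUnit (detDelta L e dV hdV dW hdW (θ p')) := by rw [detDelta_eq_of_coe_eq hθ]; exact hu'
  -- the parabolic clause of `sD` at `θ p`, tested against `C (ω(r′(m ρ)) Φ)`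
  have key := hsD.parabolic (θ p') hpθ huθ
    (piSchwartzBruhatConj (Fp L) (Fin (n + n))
      (adelicMpCont.omega (Fp L) (Fin (n + n)) (gramDA L e dV hdV dW' hdW') (rFD L e dV hdV hdV0 dW' hdW' hdW0' (levi ρ)) Φ))
  -- the three operators: outer Levi lifts fix `Φ(0)`; the middle one is `C ω(r(δ) sD(θ p) r(δ)⁻¹) C`
  have hin :
      ((adelicMpCont.omega (Fp L) (Fin (n + n)) (gramDA L e dV hdV dW' hdW') (rFD L e dV hdV hdV0 dW' hdW' hdW0' (levi ρ)) Φ :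
        piSchwartzBruhat (Fp L) (Fin (n + n))) : (Fin (n + n) → AdeleRing (𝓞 (Fp L)) (Fp L)) → ℂ) 0 =
      (Φ : (Fin (n + n) → AdeleRing (𝓞 (Fp L)) (Fp L)) → ℂ) 0 :=
    apply_zero_omega_of_mem_adelicMpZero
      (coe_ratThetaLiftCont_levi_mem_adelicMpZero (Fp L) (gramDA L e dV hdV dW' hdW') (isUnit_det_gramDA L e dV hdV hdV0 dW' hdW' hdW0') ρ) Φ
  have hmid :
      ((adelicMpCont.omega (Fp L) (Fin (n + n)) (gramDA L e dV hdV dW' hdW')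
          (mpCongr (gramDA_eq_neg (e := e) (dV := dV) (hdV := hdV) hneg).symm
            (adelicMpContConj (Fp L) (Fin (n + n)) (gramDA L e dV hdV dW hdW)
              (rDelta L e dV hdV hdV0 dW hdW hdW0 * sD (θ p') * (rDelta L e dV hdV hdV0 dW hdW hdW0)⁻¹)))
          (adelicMpCont.omega (Fp L) (Fin (n + n)) (gramDA L e dV hdV dW' hdW') (rFD L e dV hdV hdV0 dW' hdW' hdW0' (levi ρ)) Φ) :
        piSchwartzBruhat (Fp L) (Fin (n + n))) : (Fin (n + n) → AdeleRing (𝓞 (Fp L)) (Fp L)) → ℂ) 0 =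
      conj (opD L e dV hdV dW hdW (rDelta L e dV hdV hdV0 dW hdW hdW0 * sD (θ p') * (rDelta L e dV hdV hdV0 dW hdW hdW0)⁻¹)
        (piSchwartzBruhatConj (Fp L) (Fin (n + n))
          (adelicMpCont.omega (Fp L) (Fin (n + n)) (gramDA L e dV hdV dW' hdW') (rFD L e dV hdV hdV0 dW' hdW' hdW0' (levi ρ)) Φ)) 0) :=
    (congrArg (fun Θ : piSchwartzBruhat (Fp L) (Fin (n + n)) => (Θ : (Fin (n + n) → AdeleRing (𝓞 (Fp L)) (Fp L)) → ℂ) 0)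
      ((adelicMpCont.omega_mpCongr_apply (gramDA_eq_neg (e := e) (dV := dV) (hdV := hdV) hneg).symm
          (adelicMpContConj (Fp L) (Fin (n + n)) (gramDA L e dV hdV dW hdW)
            (rDelta L e dV hdV hdV0 dW hdW hdW0 * sD (θ p') * (rDelta L e dV hdV hdV0 dW hdW hdW0)⁻¹))
          (adelicMpCont.omega (Fp L) (Fin (n + n)) (gramDA L e dV hdV dW' hdW') (rFD L e dV hdV hdV0 dW' hdW' hdW0' (levi ρ)) Φ)).trans
        (adelicMpCont.omega_adelicMpContConj_apply
          (rDelta L e dV hdV hdV0 dW hdW hdW0 * sD (θ p') * (rDelta L e dV hdV hdV0 dW hdW hdW0)⁻¹)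
          (adelicMpCont.omega (Fp L) (Fin (n + n)) (gramDA L e dV hdV dW' hdW') (rFD L e dV hdV hdV0 dW' hdW' hdW0' (levi ρ)) Φ)))).trans
      (piSchwartzBruhatConj_apply _ 0)
  have hout := apply_zero_omega_of_mem_adelicMpZero
      (coe_ratThetaLiftCont_levi_inv_mem_adelicMpZero (Fp L) (gramDA L e dV hdV dW' hdW') (isUnit_det_gramDA L e dV hdV hdV0 dW' hdW' hdW0') ρ)
      (adelicMpCont.omega (Fp L) (Fin (n + n)) (gramDA L e dV hdV dW' hdW')
        (mpCongr (gramDA_eq_neg (e := e) (dV := dV) (hdV := hdV) hneg).symm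
          (adelicMpContConj (Fp L) (Fin (n + n)) (gramDA L e dV hdV dW hdW)
            (rDelta L e dV hdV hdV0 dW hdW hdW0 * sD (θ p') * (rDelta L e dV hdV hdV0 dW hdW hdW0)⁻¹)))
        (adelicMpCont.omega (Fp L) (Fin (n + n)) (gramDA L e dV hdV dW' hdW') (rFD L e dV hdV hdV0 dW' hdW' hdW0' (levi ρ)) Φ))
  -- `ω(m⁻¹ X m) Φ = ω(m⁻¹) (ω(X) (ω(m) Φ))`
  have hsplit := omega_mul_mul_apply (rFD L e dV hdV hdV0 dW' hdW' hdW0' (levi ρ))⁻¹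
    (mpCongr (gramDA_eq_neg (e := e) (dV := dV) (hdV := hdV) hneg).symm
      (adelicMpContConj (Fp L) (Fin (n + n)) (gramDA L e dV hdV dW hdW)
        (rDelta L e dV hdV hdV0 dW hdW hdW0 * sD (θ p') * (rDelta L e dV hdV hdV0 dW hdW hdW0)⁻¹)))
    (rFD L e dV hdV hdV0 dW' hdW' hdW0' (levi ρ)) Φ
  -- the scalar of `sD` at `θ p`, read at `p` and against `Φ`: `χ(det_Δ p) |det_Δ p|^{1/2} conj (Φ 0)`
  have key' := key.trans (show ((chiDet L e dV hdV dW hdW χ (θ p') : ℂˣ) : ℂ) * (modDelta L e dV hdV dW hdW (θ p') : ℂ) *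
        ((piSchwartzBruhatConj (Fp L) (Fin (n + n))
            (adelicMpCont.omega (Fp L) (Fin (n + n)) (gramDA L e dV hdV dW' hdW') (rFD L e dV hdV hdV0 dW' hdW' hdW0' (levi ρ)) Φ) :
          piSchwartzBruhat (Fp L) (Fin (n + n))) : (Fin (n + n) → AdeleRing (𝓞 (Fp L)) (Fp L)) → ℂ) 0 =
      ((chiDet L e dV hdV dW' hdW' χ p' : ℂˣ) : ℂ) * (modDelta L e dV hdV dW' hdW' p' : ℂ) *
        conj ((Φ : (Fin (n + n) → AdeleRing (𝓞 (Fp L)) (Fp L)) → ℂ) 0) by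
    rw [piSchwartzBruhatConj_apply, hin, chiDet_eq_of_coe_eq hθ, modDelta_eq_of_coe_eq hθ])
  -- assemble (a term: `opD` unfolds definitionally to `(ω · Φ) 0`)
  have fin : conj (((chiDet L e dV hdV dW' hdW' χ p' : ℂˣ) : ℂ) * (modDelta L e dV hdV dW' hdW' p' : ℂ) *
        conj ((Φ : (Fin (n + n) → AdeleRing (𝓞 (Fp L)) (Fp L)) → ℂ) 0)) =
      conj ((chiDet L e dV hdV dW' hdW' χ p' : ℂˣ) : ℂ) * (modDelta L e dV hdV dW' hdW' p' : ℂ) *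
        (Φ : (Fin (n + n) → AdeleRing (𝓞 (Fp L)) (Fp L)) → ℂ) 0 := by
    rw [map_mul (starRingEnd ℂ), map_mul (starRingEnd ℂ), Complex.conj_conj, Complex.conj_ofReal]
  exact ((congrArg (fun Θ : piSchwartzBruhat (Fp L) (Fin (n + n)) => (Θ : (Fin (n + n) → AdeleRing (𝓞 (Fp L)) (Fp L)) → ℂ) 0)
    hsplit).trans (hout.trans (hmid.trans ((congrArg conj key').trans fin))))

open Summit.HodgeConjecture.HodgeConjecture.Cruxes.H413.WeilFinRepMirror (continuous_mpCongr continuous_adelicMpContConj) in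
set_option maxHeartbeats 4000000 in
-- (same budget as ★ `isDoubledWeilRep_relabel_comp_conj`, plus the conjugate-model casts)
/-- **THE `χ`-NORMALISED DOUBLED WEIL REPRESENTATION, COMPLEX-CONJUGATED, IS THE `χ⁻¹`-NORMALISED ONE AT THE NEGATED LINE.**  For UNITARY `χ`,
`sD : H_{dW}(𝔸) →* Mp(𝕎^𝔻_{dW})ᶜᵒⁿᵗ` with `IsDoubledWeilRep χ sD`, `realDiagonal dW′ = −realDiagonal dW`, and a continuous matrix-preserving
`θ : H_{dW′}(𝔸) →* H_{dW}(𝔸)`: the mirror `sD′ := mpCongr ∘ (·)ᶜ ∘ sD ∘ θ : H_{dW′}(𝔸) →* Mp(𝕎^𝔻_{dW′})ᶜᵒⁿᵗ` satisfies `IsDoubledWeilRep χ⁻¹ sD′` —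
continuous (★ `continuous_adelicMpContConj`, `continuous_mpCongr`); over `ι′^𝔻` (§4); parabolic scalar `conj χ(det_Δ p) |det_Δ p|^{1/2} = χ⁻¹(det_Δ p) |det_Δ p|^{1/2}`
(§5, unitarity).  [Li1992, p. 181] «the restriction of `ω□` to the diagonal is `ω ⊗ ω*` … `ω*` is the same as `ω_{ψ̄}`»; [Liu2021, App. D Lem. D.1 (2)]
«`\overline{ω(μ,ε,χ)} ≅ ω(μᶜ, −ε, χ⁻¹)`» at the level of the doubled splittings.
[cite: GelbartRogawski1991, §3.1 Prop. 3.1.1 p. 455 L1–2, Remark p. 457 L4–13] [cite: HarrisKudlaSweet1996, §1 (1.14)–(1.15)] [cite: Kudla1994, §3 Thm. 3.1] [cite: Li1992, p. 181] -/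
theorem isDoubledWeilRep_mirror (hdV0 : ∀ i, dV i ≠ 0) (hdW0 : ∀ i, dW i ≠ 0) (hdW0' : ∀ i, dW' i ≠ 0)
    (hneg : realDiagonal L dW' hdW' = -realDiagonal L dW hdW)
    (hθ : ∀ h : HA L e dV hdV dW' hdW',
      (((θ h : HA L e dV hdV dW hdW) : GL (Fin (n + n)) (AdeleRing (𝓞 L) L)) : Matrix (Fin (n + n)) (Fin (n + n)) (AdeleRing (𝓞 L) L)) =
        (((h : HA L e dV hdV dW' hdW') : GL (Fin (n + n)) (AdeleRing (𝓞 L) L)) : Matrix (Fin (n + n)) (Fin (n + n)) (AdeleRing (𝓞 L) L)))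
    (hθc : Continuous θ) (χ : HeckeCharacter L) (hχu : χ.IsUnitary)
    {sD : HA L e dV hdV dW hdW →* MpD L e dV hdV dW hdW} (hsD : IsDoubledWeilRep L e dV hdV hdV0 dW hdW hdW0 χ sD) :
    IsDoubledWeilRep L e dV hdV hdV0 dW' hdW' hdW0' χ⁻¹
      (((mpCongr (gramDA_eq_neg (e := e) (dV := dV) (hdV := hdV) hneg).symm).toMonoidHom.comp
          ((adelicMpContConj (Fp L) (Fin (n + n)) (gramDA L e dV hdV dW hdW)).toMonoidHom.comp sD)).comp θ) := by
  refine ⟨?_, fun h => proj_mirror hneg hθ hsD.proj_eq h, fun p hp hu Φ => ?_⟩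
  · exact (continuous_mpCongr (gramDA_eq_neg (e := e) (dV := dV) (hdV := hdV) hneg).symm).comp
      ((continuous_adelicMpContConj (gramDA L e dV hdV dW hdW)).comp (hsD.continuous.comp hθc))
  · rw [opD_mirror_parabolic hdV0 hdW0 hdW0' hneg hθ χ hsD
        ⟨Matrix.reindex (e₂ (n := n)) (e₂ (n := n)) (Matrix.fromBlocks (1 : Matrix (Fin n) (Fin n) (Fp L)) 0 0 (-1)),
          Matrix.reindex (e₂ (n := n)) (e₂ (n := n)) (Matrix.fromBlocks (1 : Matrix (Fin n) (Fin n) (Fp L)) 0 0 (-1)),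
          reindex_fromBlocks_one_neg_one_mul_self (Fp L) n, reindex_fromBlocks_one_neg_one_mul_self (Fp L) n⟩ rfl p hp hu Φ,
      coe_chiDet_inv χ hχu]

/-- **the instance of record**: `θ :=` the identity of matrices `H_{dW′}(𝔸) = H_{dW}(𝔸)` (★ `HA_eq`). [cite: GelbartRogawski1991, §3.1 Prop. 3.1.1 p. 455 L1–2] [cite: Kudla1994, §3 Thm. 3.1] -/
theorem isDoubledWeilRep_mirror_subgroupCongr (hdV0 : ∀ i, dV i ≠ 0) (hdW0 : ∀ i, dW i ≠ 0) (hdW0' : ∀ i, dW' i ≠ 0)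
    (hneg : realDiagonal L dW' hdW' = -realDiagonal L dW hdW) (χ : HeckeCharacter L) (hχu : χ.IsUnitary)
    {sD : HA L e dV hdV dW hdW →* MpD L e dV hdV dW hdW} (hsD : IsDoubledWeilRep L e dV hdV hdV0 dW hdW hdW0 χ sD) :
    IsDoubledWeilRep L e dV hdV hdV0 dW' hdW' hdW0' χ⁻¹
      (((mpCongr (gramDA_eq_neg (e := e) (dV := dV) (hdV := hdV) hneg).symm).toMonoidHom.comp
          ((adelicMpContConj (Fp L) (Fin (n + n)) (gramDA L e dV hdV dW hdW)).toMonoidHom.comp sD)).comp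
        (MulEquiv.subgroupCongr (HA_eq (e := e) (dV := dV) (hdV := hdV) hneg)).toMonoidHom) :=
  isDoubledWeilRep_mirror hdV0 hdW0 hdW0' hneg (coe_subgroupCongr_HA_eq hneg) (continuous_subgroupCongr_HA_eq hneg) χ hχu hsD

end Mirror

end Summit.HodgeConjecture.HodgeConjecture.Cruxes.HLiu418.DoubledWeilMirror

end
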